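import Summits.ABC.StewartYu.DescentThirdLiouvilleQ
import Summits.ABC.StewartYu.DescentStepThirdQ
import HarnessLib

/-!
# Cell abc-stewartyu, W80Two: the THIRD STEP of the `2`-adic descent — from `2`-adic smallness at the
# third points to the invariant one level up

`Summits/ABC/StewartYu/PadicTwoThirdStep.lean` — cell `abc-stewartyu` (seat p3; route
`PadicPrimesW80TwoThirds`, crux `W80Two` stmt-ABC-19486; theorems only, no named fact).  Base-`3` twin
of p2's `TwistSetup.inv_succ_of_norm_Φ_half_lt` (`PadicTwistHalfStep.lean`) WITHOUT class (there is no
twist at `p = 2`), with the sizes kept ABSTRACT per `(s,τ)` in the style of p3-g2's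
`halfStepPM_of_numerics` (the `q = 3` record supplies the closed forms later): from p2's invariant
`SetupQ.Inv3` at level `J < J₀`, per-`(s,τ)` denominators `D(s,τ) ≥ 1` of the next-level weights
`(qΔ3_{J₀,J+1}·qA)·qEt` on the box of level `J`, per-`(s,τ)` sizes
`∑_{u ∈ box} P·|qΔ3·qA·qEt| ≤ Mb(s,τ)` (`Mb ≥ 1`), and the `2`-adic smallness
`‖φ_{J,τ}(s/3)‖₂ < 1/(6·D(s,τ)·Mb(s,τ)·∏ max(1,|allᵢ|))^{3^{d+2}−1}` at all `s < 3^{J+1} S₀`, `3 ∤ s`,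
`|τ| < T/3^{J+1}`, the invariant at level `J + 1` — by `TwoSetup.classVec3_eq_zero_of_norm_Φ_third_lt`
(multicubic Liouville, integer generators, cube-Kummer) and p2's algebraic third step
`SetupQ.descent_algebra3`.  Everything is [folklore].

## References
* [Yu1989] K. Yu, Acta Arith. 53 (1989), §3 (the `q`-descent).
* [Yu1990] K. Yu, Compositio Math. 74 (1990), §1.1 (`p = 2`, `q = 3`), §2.4 Lemma 2.5.
-/

noncomputable section

open Finset
open Literature.NumberTheory.Transcendental
open Literature.NumberTheory.Transcendental.CW77.Setup (Idx Tau tauNorm)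

namespace Summit.ABC.StewartYu

namespace TwoSetup

variable (S : TwoSetup) {h Lb : ℕ}

/-- **`ℓ¹` of the triadic class sums from the coefficient bound**: if `|p(u)| ≤ P` for all `u` and
`∑_{u ∈ box} P·|c(u)·qEt(u,s)| ≤ Mb`, then `∑_κ |classVec3 box p c s κ| ≤ Mb`. [folklore] -/
theorem sum_abs_classVec3_le_of_bound (box : Finset (Idx S.d h Lb)) (pv : Idx S.d h Lb → ℤ)
    (c : Idx S.d h Lb → ℚ) (s : ℕ) {P : ℤ} (hP : ∀ u, |pv u| ≤ P) {Mb : ℝ}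
    (hMbP : ∑ u ∈ box, (P : ℝ) * |((c u * S.toQ.qEt u s : ℚ) : ℝ)| ≤ Mb) :
    ∑ κ, |(S.toQ.classVec3 box pv c s κ : ℝ)| ≤ Mb := by
  refine (S.toQ.sum_abs_classVec3_le box pv c s).trans (le_trans ?_ hMbP)
  refine sum_le_sum fun u _ => mul_le_mul_of_nonneg_right ?_ (abs_nonneg _)
  have := hP u
  rw [← Int.cast_abs]; exact_mod_cast this

/-- **The third step of the `2`-adic descent** (twin of `TwistSetup.inv_succ_of_norm_Φ_half_lt`, sizes
abstract per `(s,τ)`): integer generators with the cube-Kummer condition; from the invariant `Inv3` at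
level `J < J₀`, per-`(s,τ)` denominators `1 ≤ D(s,τ)` of the weights
`(qΔ3_{J₀,J+1}(u;τ₀,s)·qA(u,τ'))·qEt(u,s)` on the box of level `J`, sizes
`∑_{u ∈ box} P·|qΔ3·qA·qEt| ≤ Mb(s,τ)` (`1 ≤ Mb`) and the `2`-adic smallness
`‖φ_{J,τ}(s/3)‖₂ < 1/(6·D(s,τ)·Mb(s,τ)·∏ᵢ max(1,|allᵢ|))^{3^{d+2}−1}` for all `s < 3^{J+1} S₀`,
`3 ∤ s`, `|τ| < T/3^{J+1}`, the invariant holds at level `J + 1`. [folklore] -/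
theorem inv3_succ_of_norm_Φ_third_lt {J₀ J : ℕ} {L : Fin S.d → ℕ} {Lθ S₀ T : ℕ} {P : ℤ}
    {pv : Idx S.d h Lb → ℤ} (inv : S.toQ.Inv3 (h := h) (Lb := Lb) J₀ L Lθ S₀ T P J pv)
    (hint : ∀ i, ∃ a : ℤ, S.toQ.all i = a)
    (hind : ∀ κ : Fin (S.d + 1) → ℕ, (∃ j, ¬ 3 ∣ κ j) → ∀ γ : ℚ, ∏ j, S.toQ.all j ^ κ j ≠ γ ^ 3)
    (hJ : J < J₀) (D : ℕ → Tau S.d → ℕ) (hD : ∀ s τ, 1 ≤ D s τ)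
    (hDc : ∀ s (τ : Tau S.d), ∀ u ∈ S.toQ.box3 (h := h) (Lb := Lb) L Lθ J, ∃ z : ℤ, (D s τ : ℚ) *
      ((S.toQ.qΔ3 J₀ (J + 1) u τ.1 s * S.frame.qA u τ.2) * S.toQ.qEt u s) = z)
    (Mb : ℕ → Tau S.d → ℝ) (hMb : ∀ s τ, 1 ≤ Mb s τ)
    (hMbP : ∀ s (τ : Tau S.d), ∑ u ∈ S.toQ.box3 (h := h) (Lb := Lb) L Lθ J,
      (P : ℝ) * |((S.toQ.qΔ3 J₀ (J + 1) u τ.1 s * S.frame.qA u τ.2 * S.toQ.qEt u s : ℚ) : ℝ)| ≤ Mb s τ)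
    (hsmall : ∀ s, s < 3 ^ (J + 1) * S₀ → ¬ 3 ∣ s → ∀ τ : Tau S.d, tauNorm τ < T / 3 ^ (J + 1) →
      ‖S.Φ J₀ J (S.toQ.box3 (h := h) (Lb := Lb) L Lθ J) pv τ ((s : ℚ_[2]) * ((3 : ℕ) : ℚ_[2])⁻¹)‖ <
        1 / (6 * (D s τ : ℝ) * Mb s τ * ∏ i, max 1 |(S.toQ.all i : ℝ)|) ^ (3 ^ (S.d + 1 + 1) - 1)) :
    ∃ pv' : Idx S.d h Lb → ℤ, S.toQ.Inv3 (h := h) (Lb := Lb) J₀ L Lθ S₀ T P (J + 1) pv' := by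
  refine S.toQ.descent_algebra3 inv fun s hs h3 τ hτ => ?_
  exact S.classVec3_eq_zero_of_norm_Φ_third_lt hint hind hJ _ pv τ s (hD s τ) (hDc s τ) (hMb s τ)
    (S.sum_abs_classVec3_le_of_bound _ pv _ s inv.bound (hMbP s τ)) (hsmall s hs h3 τ hτ)

end TwoSetup

end Summit.ABC.StewartYu

end
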